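import Literature.Computability.QuantumComplexity.SolovayKitaev.Basic
import Mathlib.LinearAlgebra.Matrix.Adjugate
import HarnessLib

/-!
# Chord geometry of `SU(2)`: `‖A - B‖² = 2 - Re tr(A†B)`, trace identities, commutator bound

Topic `Literature/Computability/QuantumComplexity`. Proof infrastructure for the braid COMPILER of
the `PromiseBQP`-hardness reduction to the Jones polynomial at `k = 5` (Aharonov–Arad 2011, Thm.
3.1: "apply the Solovay–Kitaev theorem to the dense images"): the reduction machine approximates
target gates by braid words using only EXACT arithmetic, and what makes this possible is that in
`SU(2)` operator-norm distances are traces: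

* `star_coe_eq_adjugate`, `coe_add_star` — for `U ∈ SU(2)`, `U† = adj U = tr(U)·1 - U`
  (Cayley–Hamilton in dimension two), so `tr U` is real (`trace_coe_im`) and
* **`norm_one_sub_coe_sq`**: `‖1 - U‖² = 2 - Re tr U` (`(1-U)†(1-U) = (2 - tr U)·1` and the
  `C⋆`-identity), hence **`norm_coe_sub_coe_sq`**: `‖A - B‖² = 2 - Re tr(A†B)` for `A, B ∈ SU(2)`
  — closeness of unitaries is decided by one trace;
* `abs_trace_re_le_two`, `norm_one_sub_le_two`;
* `trace_mul_mul_adjugate_mul_adjugate` — the Fricke–Klein trace identity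
  `tr(U V adjU adjV) = tr(U)² det V + tr(V)² det U + tr(UV)² - tr U tr V tr(UV) - 2 det U det V`
  for all `2 × 2` matrices over a commutative ring (so `tr[U,V] = x² + y² + z² - xyz - 2` in
  `SU(2)`: the angle of a group commutator from three traces);
* `norm_comm_sub_one_le` — `‖UVU†V† - 1‖ ≤ 2 ‖U - 1‖ ‖V - 1‖` for unitaries (group commutators
  of small elements are quadratically small; Dawson–Nielsen 2006 §4).

All norms are `L²`-operator norms (`open scoped Matrix.Norms.L2Operator`).

## References

* D. Aharonov, I. Arad, New J. Phys. 13 (2011) 035019, §3.3–§4 [AharonovArad2011].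
* C. M. Dawson, M. A. Nielsen, *The Solovay–Kitaev algorithm*, QIC 6 (2006), §4 [DawsonNielsen2006].
-/

noncomputable section

open scoped Matrix.Norms.L2Operator

namespace Literature.Computability.QuantumComplexity

open Matrix

/-! ### Cayley–Hamilton in dimension two -/

section CH

variable {R : Type*} [CommRing R]

/-- `adj M = tr(M)·1 - M` for `2 × 2` matrices. [folklore] -/
theorem adjugate_fin_two_eq_trace_smul_sub (M : Matrix (Fin 2) (Fin 2) R) :
    adjugate M = M.trace • (1 : Matrix (Fin 2) (Fin 2) R) - M := by
  rw [Matrix.adjugate_fin_two, Matrix.trace_fin_two]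
  ext i j
  fin_cases i <;> fin_cases j <;> simp

/-- **Fricke–Klein trace identity** for `2 × 2` matrices:
`tr(U V adjU adjV) = tr(U)² det V + tr(V)² det U + tr(UV)² - tr U · tr V · tr(UV) - 2 det U det V`.
[folklore] -/
theorem trace_mul_mul_adjugate_mul_adjugate (U V : Matrix (Fin 2) (Fin 2) R) :
    (U * V * adjugate U * adjugate V).trace =
      U.trace ^ 2 * V.det + V.trace ^ 2 * U.det + (U * V).trace ^ 2 - U.trace * V.trace * (U * V).trace -
        2 * U.det * V.det := by
  rw [Matrix.adjugate_fin_two, Matrix.adjugate_fin_two]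
  simp only [Matrix.trace_fin_two, Matrix.det_fin_two, Matrix.mul_apply, Fin.sum_univ_two, Matrix.of_apply,
    Matrix.cons_val', Matrix.cons_val_zero, Matrix.cons_val_one, Matrix.empty_val', Matrix.cons_val_fin_one]
  ring

end CH

/-! ### `SU(2)`: adjoint, trace, chord distance -/

section SUTwo

/-- In `SU(2)`, `U† = adj U`. [folklore] -/
theorem star_coe_eq_adjugate (U : (Matrix.specialUnitaryGroup (Fin 2) ℂ)) : star (U : Matrix (Fin 2) (Fin 2) ℂ) = adjugate (U : Matrix (Fin 2) (Fin 2) ℂ) := by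
  have hU := Matrix.mem_specialUnitaryGroup_iff.1 U.2
  have h1 : star (U : Matrix (Fin 2) (Fin 2) ℂ) * (U : Matrix (Fin 2) (Fin 2) ℂ) = 1 := Unitary.star_mul_self_of_mem hU.1
  have h2 : adjugate (U : Matrix (Fin 2) (Fin 2) ℂ) * (U : Matrix (Fin 2) (Fin 2) ℂ) = 1 := by
    rw [Matrix.adjugate_mul, hU.2, one_smul]
  -- both are left inverses of `U`
  calc star (U : Matrix (Fin 2) (Fin 2) ℂ)
      = star (U : Matrix (Fin 2) (Fin 2) ℂ) * ((U : Matrix (Fin 2) (Fin 2) ℂ) * adjugate (U : Matrix (Fin 2) (Fin 2) ℂ)) := by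
        rw [Matrix.mul_adjugate, hU.2, one_smul, Matrix.mul_one]
    _ = adjugate (U : Matrix (Fin 2) (Fin 2) ℂ) := by rw [← Matrix.mul_assoc, h1, Matrix.one_mul]

/-- **`U + U† = tr(U)·1` in `SU(2)`.** [folklore] -/
theorem coe_add_star (U : (Matrix.specialUnitaryGroup (Fin 2) ℂ)) :
    (U : Matrix (Fin 2) (Fin 2) ℂ) + star (U : Matrix (Fin 2) (Fin 2) ℂ) = (U : Matrix (Fin 2) (Fin 2) ℂ).trace • 1 := by
  rw [star_coe_eq_adjugate, adjugate_fin_two_eq_trace_smul_sub]; abel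

/-- The trace of an element of `SU(2)` is real. [folklore] -/
theorem trace_coe_im (U : (Matrix.specialUnitaryGroup (Fin 2) ℂ)) : ((U : Matrix (Fin 2) (Fin 2) ℂ).trace).im = 0 := by
  have h := congrArg Matrix.trace (star_coe_eq_adjugate U)
  rw [Matrix.star_eq_conjTranspose, Matrix.trace_conjTranspose, adjugate_fin_two_eq_trace_smul_sub, Matrix.trace_sub,
    Matrix.trace_smul, Matrix.trace_one] at h
  simp only [Fintype.card_fin, smul_eq_mul] at h
  -- `conj t = 2t - t = t`
  have e : star ((U : Matrix (Fin 2) (Fin 2) ℂ).trace) = (U : Matrix (Fin 2) (Fin 2) ℂ).trace := by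
    rw [h]; push_cast; ring
  have := congrArg Complex.im e
  rw [Complex.star_def, Complex.conj_im] at this
  linarith

/-- `|Re tr U| ≤ 2` in `SU(2)` (entries of a unitary have modulus `≤ 1`). [folklore] -/
theorem abs_trace_re_le_two (U : (Matrix.specialUnitaryGroup (Fin 2) ℂ)) : |((U : Matrix (Fin 2) (Fin 2) ℂ).trace).re| ≤ 2 := by
  rw [Matrix.trace_fin_two, Complex.add_re]
  have h0 := SolovayKitaev.norm_apply_le_norm (U : Matrix (Fin 2) (Fin 2) ℂ) 0 0
  have h1 := SolovayKitaev.norm_apply_le_norm (U : Matrix (Fin 2) (Fin 2) ℂ) 1 1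
  have hU := SolovayKitaev.norm_coe_le_one U
  have r0 := Complex.abs_re_le_norm ((U : Matrix (Fin 2) (Fin 2) ℂ) 0 0)
  have r1 := Complex.abs_re_le_norm ((U : Matrix (Fin 2) (Fin 2) ℂ) 1 1)
  rw [abs_le] at r0 r1 ⊢
  constructor <;> linarith [r0.1, r0.2, r1.1, r1.2]

/-- **The chord formula**: `‖1 - U‖² = 2 - Re tr U` for `U ∈ SU(2)`. [folklore] -/
theorem norm_one_sub_coe_sq (U : (Matrix.specialUnitaryGroup (Fin 2) ℂ)) :
    ‖(1 : Matrix (Fin 2) (Fin 2) ℂ) - (U : Matrix (Fin 2) (Fin 2) ℂ)‖ ^ 2 = 2 - ((U : Matrix (Fin 2) (Fin 2) ℂ).trace).re := by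
  set X : Matrix (Fin 2) (Fin 2) ℂ := 1 - (U : Matrix (Fin 2) (Fin 2) ℂ) with hX
  have hcs : ‖star X * X‖ = ‖X‖ * ‖X‖ := CStarRing.norm_star_mul_self
  have hXX : star X * X = ((2 : ℂ) - (U : Matrix (Fin 2) (Fin 2) ℂ).trace) • (1 : Matrix (Fin 2) (Fin 2) ℂ) := by
    have hU := Matrix.mem_specialUnitaryGroup_iff.1 U.2
    have h1 : star (U : Matrix (Fin 2) (Fin 2) ℂ) * (U : Matrix (Fin 2) (Fin 2) ℂ) = 1 := Unitary.star_mul_self_of_mem hU.1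
    have e1 : star X * X = (2 : ℂ) • (1 : Matrix (Fin 2) (Fin 2) ℂ) -
        ((U : Matrix (Fin 2) (Fin 2) ℂ) + star (U : Matrix (Fin 2) (Fin 2) ℂ)) := by
      rw [hX, star_sub, star_one]
      calc (1 - star (U : Matrix (Fin 2) (Fin 2) ℂ)) * (1 - (U : Matrix (Fin 2) (Fin 2) ℂ))
          = 1 - (U : Matrix (Fin 2) (Fin 2) ℂ) - star (U : Matrix (Fin 2) (Fin 2) ℂ) +
              star (U : Matrix (Fin 2) (Fin 2) ℂ) * (U : Matrix (Fin 2) (Fin 2) ℂ) := by noncomm_ring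
        _ = _ := by rw [h1, two_smul]; abel
    rw [e1, coe_add_star, ← sub_smul]
  have htr : ((2 : ℂ) - (U : Matrix (Fin 2) (Fin 2) ℂ).trace) = (((2 - ((U : Matrix (Fin 2) (Fin 2) ℂ).trace).re : ℝ)) : ℂ) := by
    apply Complex.ext <;> simp [trace_coe_im]
  have hnn : 0 ≤ 2 - ((U : Matrix (Fin 2) (Fin 2) ℂ).trace).re := by
    have := abs_trace_re_le_two U; rw [abs_le] at this; linarith
  rw [hXX, htr, norm_smul, CStarRing.norm_one, mul_one, Complex.norm_real, Real.norm_of_nonneg hnn] at hcs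
  rw [sq, ← hcs]

/-- `‖1 - U‖ ≤ 2` in `SU(2)`. [folklore] -/
theorem norm_one_sub_coe_le_two (U : (Matrix.specialUnitaryGroup (Fin 2) ℂ)) : ‖(1 : Matrix (Fin 2) (Fin 2) ℂ) - (U : Matrix (Fin 2) (Fin 2) ℂ)‖ ≤ 2 := by
  have h := norm_one_sub_coe_sq U
  have h2 := abs_trace_re_le_two U
  rw [abs_le] at h2
  nlinarith [norm_nonneg ((1 : Matrix (Fin 2) (Fin 2) ℂ) - (U : Matrix (Fin 2) (Fin 2) ℂ))]

/-- **Distances are traces**: `‖A - B‖² = 2 - Re tr(A†B)` for `A, B ∈ SU(2)`. [folklore] -/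
theorem norm_coe_sub_coe_sq (A B : (Matrix.specialUnitaryGroup (Fin 2) ℂ)) :
    ‖(A : Matrix (Fin 2) (Fin 2) ℂ) - (B : Matrix (Fin 2) (Fin 2) ℂ)‖ ^ 2 =
      2 - ((star (A : Matrix (Fin 2) (Fin 2) ℂ) * (B : Matrix (Fin 2) (Fin 2) ℂ)).trace).re := by
  have e : ‖(A : Matrix (Fin 2) (Fin 2) ℂ) - (B : Matrix (Fin 2) (Fin 2) ℂ)‖ =
      ‖(1 : Matrix (Fin 2) (Fin 2) ℂ) - ((A⁻¹ * B : (Matrix.specialUnitaryGroup (Fin 2) ℂ)) : Matrix (Fin 2) (Fin 2) ℂ)‖ := by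
    rw [← SolovayKitaev.norm_coe_mul A⁻¹, mul_sub]
    congr 1
    rw [SolovayKitaev.coe_inv, Unitary.star_mul_self_of_mem (Matrix.mem_specialUnitaryGroup_iff.1 A.2).1]
    rfl
  rw [e, norm_one_sub_coe_sq]
  rfl

/-- **The chord pseudo-size is a trace**: for `U ∈ SU(2)`, `‖1 - U‖ ≤ r ↔ 2 - r² ≤ Re tr U` (`r ≥ 0`).
[folklore] -/
theorem norm_one_sub_coe_le_iff (U : (Matrix.specialUnitaryGroup (Fin 2) ℂ)) {r : ℝ} (hr : 0 ≤ r) :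
    ‖(1 : Matrix (Fin 2) (Fin 2) ℂ) - (U : Matrix (Fin 2) (Fin 2) ℂ)‖ ≤ r ↔ 2 - r ^ 2 ≤ ((U : Matrix (Fin 2) (Fin 2) ℂ).trace).re := by
  have h := norm_one_sub_coe_sq U
  have hn := norm_nonneg ((1 : Matrix (Fin 2) (Fin 2) ℂ) - (U : Matrix (Fin 2) (Fin 2) ℂ))
  constructor
  · intro hle
    have : ‖(1 : Matrix (Fin 2) (Fin 2) ℂ) - (U : Matrix (Fin 2) (Fin 2) ℂ)‖ ^ 2 ≤ r ^ 2 := pow_le_pow_left₀ hn hle 2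
    linarith
  · intro hle
    have hsq : ‖(1 : Matrix (Fin 2) (Fin 2) ℂ) - (U : Matrix (Fin 2) (Fin 2) ℂ)‖ ^ 2 ≤ r ^ 2 := by rw [h]; linarith
    exact (pow_le_pow_iff_left₀ hn hr two_ne_zero).1 hsq

end SUTwo

/-! ### Group commutators of small unitaries -/

section Comm

variable {n : Type*} [Fintype n] [DecidableEq n]

/-- **`‖UVU†V† - 1‖ ≤ 2 ‖U - 1‖ ‖V - 1‖`** for unitary `U, V`
(`UVU†V† - 1 = (UV - VU)U†V†`, `UV - VU = (U-1)(V-1) - (V-1)(U-1)`). [cite: DawsonNielsen2006, §4] -/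
theorem norm_comm_sub_one_le {U V : Matrix n n ℂ} (hU : U ∈ Matrix.unitaryGroup n ℂ) (hV : V ∈ Matrix.unitaryGroup n ℂ) :
    ‖U * V * star U * star V - 1‖ ≤ 2 * ‖U - 1‖ * ‖V - 1‖ := by
  have hUs : U * star U = 1 := Unitary.mul_star_self_of_mem hU
  have hVs : V * star V = 1 := Unitary.mul_star_self_of_mem hV
  have e : U * V * star U * star V - 1 = (U * V - V * U) * (star U * star V) := by
    have e1 : (U * V - V * U) * (star U * star V) = U * V * star U * star V - V * (U * star U) * star V := by
      noncomm_ring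
    rw [e1, hUs, Matrix.mul_one, hVs]
  have e2 : U * V - V * U = (U - 1) * (V - 1) - (V - 1) * (U - 1) := by noncomm_ring
  have hst : ‖star U * star V‖ ≤ 1 :=
    calc ‖star U * star V‖ ≤ ‖star U‖ * ‖star V‖ := Matrix.l2_opNorm_mul _ _
      _ ≤ 1 * 1 := mul_le_mul (SolovayKitaev.norm_star_le_one_of_mem_unitaryGroup hU)
          (SolovayKitaev.norm_star_le_one_of_mem_unitaryGroup hV) (norm_nonneg _) zero_le_one
      _ = 1 := mul_one _
  calc ‖U * V * star U * star V - 1‖ = ‖(U * V - V * U) * (star U * star V)‖ := by rw [e]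
    _ ≤ ‖U * V - V * U‖ * ‖star U * star V‖ := Matrix.l2_opNorm_mul _ _
    _ ≤ ‖U * V - V * U‖ * 1 := mul_le_mul_of_nonneg_left hst (norm_nonneg _)
    _ = ‖(U - 1) * (V - 1) - (V - 1) * (U - 1)‖ := by rw [mul_one, e2]
    _ ≤ ‖(U - 1) * (V - 1)‖ + ‖(V - 1) * (U - 1)‖ := norm_sub_le _ _
    _ ≤ ‖U - 1‖ * ‖V - 1‖ + ‖V - 1‖ * ‖U - 1‖ := add_le_add (Matrix.l2_opNorm_mul _ _) (Matrix.l2_opNorm_mul _ _)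
    _ = 2 * ‖U - 1‖ * ‖V - 1‖ := by ring

end Comm

end Literature.Computability.QuantumComplexity

end
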